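import Summits.BirchSwinnertonDyer.Rank1Residual.X1.CyclotomicFactorPow
import Summits.BirchSwinnertonDyer.Rank1Residual.X1.CyclotomicZerosLeaf
import HarnessLib

/-!
# Route C on the leaf X1 ∩ {r = 0} FROM A RANK-GROWTH CERTIFICATE: `BSD(E,p)` end to end
# (cell `b2b-bsdres`; prover unit `b2b-bsdres-additive-p3`, gen 15, for eisenstein-p1's route C)

HONEST FRAMING (run/shared/lean/b2b/bsd-rank1-residual/, verbatim in every file): the goal of the
cell is to DELETE the COMBINATION-SHAPED residual classes of the Birch–Swinnerton-Dyer formula for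
ALL analytic-rank `≤ 1` elliptic curves over `ℚ` — "full BSD formula for every rank `≤ 1` curve in
class `C`" assembled STRICTLY from published theorems — so that the rank-`≤ 1` remainder becomes
exactly the CONSTRUCTION-SHAPED classes, which are TYPED (missing-input `Prop`s), NOT attempted.
This is not "finishing BSD". Sub-cell of eisenstein-p1's class X1 ∩ {r = 0} (research route; NO
CLAIM BEYOND STATED CLASSES); THEOREMS ONLY over PUBLISHED named facts (hW16 = Wuthrich 2014
Thm 16, hGr = Greenberg Thm 4.1, h310 = Greenberg Prop 3.10, hmod = modularity, hGZK =
Gross–Zagier–Kolyvagin — exactly the hypotheses of eisenstein-p1's `X1/CyclotomicZerosLeaf.lean`)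
and the cell's typed per-pair inputs; nothing about any particular curve is asserted; nothing
booked; no label changes.

With Greenberg's p. 132 step a theorem (`Iwasawa/RankGrowthCyclotomicFactor.lean`), the typed
input `ξ_p ∣ f_E` of eisenstein-p1's leaf theorems is replaced by a RANK-GROWTH CERTIFICATE
`Iwasawa.LayerRankGEAt W p 1 ((p−1)·t)` (`rank E(ℚ_1) ≥ (p−1)t`, iw-1's census datum: an explicit
point of infinite order over `ℚ(ζ_9)⁺` for `t = 1`, `p = 3`; a `ℤ`-rank-4 certificate at a double
zero for `t = 2`):

* `Leaf.mazurMainConjecture_of_layerRankGEAt_pow`, `Leaf.bsdp_of_layerRankGEAt_pow`: on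
  `RankZero.Leaf W p`, certificate + `AnalyticMuLE m` + `MuPartAt` + `AnalyticLambdaEq n` +
  hb(t) : `m + t + 1 + 2·v_p #E(ℚ)_tors ≤ v_p ∏c_ℓ + 2·v_p #Ẽ(𝔽_p)` + `n ≤ t(p−1) + 2` ⇒
  Mazur's main conjecture ⇒ `BSD(E,p)`;
* headlines at `p = 3`, `μ_an = 0`: `rank E(ℚ_1) ≥ 2 ∧ λ_an = 4 ∧ hb(1)` ⇒ `BSD(E,3)`
  (`Leaf.bsdp_three_of_layerRankGE_two`; eisenstein-p1's 'C' classes, e.g. their 14534b1) and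
  `rank E(ℚ_1) ≥ 4 ∧ λ_an = 6 ∧ hb(2)` ⇒ `BSD(E,3)` (`Leaf.bsdp_three_of_layerRankGE_four`; the
  double-zero 'C²' shape, e.g. 11170d1: `3 ≤ v_3 ∏c_ℓ + 2·v_3 #Ẽ(𝔽_3) − 2·v_3 #E(ℚ)_tors`).
Instances are the owners' (eisenstein-p1 / iw-1) to book from their certificate tables.

References: [GreenbergLNM1716] Thm. 1.2, Prop. 3.10, Thm. 4.1, §5 p. 132; [Wuthrich2014] Thm. 16.
-/

noncomputable section

open scoped Classical MatrixGroups ModularForm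

open PowerSeries CongruenceSubgroup WeierstrassCurve Literature.NumberTheory.EllipticCurves
  Literature.NumberTheory.EllipticCurves.ModularForms
  Literature.NumberTheory.EllipticCurves.Rank1Residual
  Literature.NumberTheory.EllipticCurves.Greenberg1999
  Summit.BirchSwinnertonDyer.BirchSwinnertonDyer.Theorems.Rank1ResidualX1Defs
  Summit.BirchSwinnertonDyer.Rank1Residual.X1.MuLambda
  Summit.BirchSwinnertonDyer.Rank1Residual.X1.MuPart
  Summit.BirchSwinnertonDyer.Rank1Residual.X1.ParitySqueeze
  Summit.BirchSwinnertonDyer.Rank1Residual.X1.CyclotomicZeros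

set_option autoImplicit false

namespace Summit.BirchSwinnertonDyer.Rank1Residual.X1.CyclotomicFactorPow

section NoConstantTerm

variable {W : WeierstrassCurve ℚ} [W.IsElliptic] [W.IsGloballyMinimal] {p : ℕ} [Fact p.Prime]

/-- **Route C^t without the constant term: `μ-part ∧ λ_an = n ≤ t(p − 1) ∧ ξ_p^t ∣ f_E` (torsion-
guarded) ⇒ Mazur's main conjecture** — eisenstein-p1's `mazurMainConjecture_of_cyclotomicFactor`
with `ξ ↦ ξ^t` and the GUARDED shape (`D.IsTorsion` is obtained inside from Wuthrich Thm 16, so a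
rank-growth certificate can feed it): `λ(f_E) ≥ λ(ξ_p^t) = t(p − 1) ≥ n = λ(f_E·h)` ⇒ `λ(h) = 0`.
Useful at `p ≥ 5` (`λ_an = 4` at `p = 5`, `t = 1`). [cite: Wuthrich2014, Thm. 16 (p. 397)]
[cite: GreenbergLNM1716, §5 p. 132] -/
theorem mazurMainConjecture_of_cyclotomicFactorPowTorsion
    (hW16 : Wuthrich2014.charIdeal_dvd_padicLFunction)
    (hp : p ≠ 2) (hgood : W.HasGoodReductionAtPrime p) (hord : ¬ (p : ℤ) ∣ W.frobeniusTrace p)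
    (hred : ¬ W.HasIrreducibleModPGaloisRep p) (hμ : MuLambda.MuPartAt W p) {n : ℕ}
    (hlam : AnalyticLambdaEq W p n) {t : ℕ} (hξ : Iwasawa.CyclotomicFactorPowAtTorsion W p t)
    (hn : n ≤ t * (p - 1)) : MazurMainConjecture W p := by
  refine (mazurMainConjecture_iff_muPart_and_lambdaPart hW16 hp hgood hord hred).mpr ⟨hμ, ?_⟩
  intro κ γ hκ hγ hγ' _ f hf ϖ hϖ D g h hchar hι
  have hordp : IsOrdinaryAt W p := ⟨hgood, hord⟩
  haveI : Module.Finite (IwasawaAlgebra p) D.X := D.module_finite_holds hγ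
  obtain ⟨hX, -⟩ := hW16 W p hp hordp hred hκ hγ hγ' hf D ϖ hϖ
  have hgh : g * h ≠ 0 := mul_ne_zero_of_iota_eq hgood hord hf hϖ D hι
  have hg : g ≠ 0 := fun h0 ↦ hgh (by rw [h0, zero_mul])
  obtain ⟨q, hq⟩ := hξ κ γ hκ hγ hγ' D hX g hchar
  obtain ⟨-, hlamg, -, -⟩ := lam_eq_of_xi_pow_dvd t hg hq
  have h1 : lam (g * h) = n := hlam f hf ϖ hϖ (g * h) hι
  omega

/-- **Certificate form: `rank E(ℚ_1) ≥ (p−1)t + rank E(ℚ)`-type certificate with `rank E(ℚ) ≤ r`,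
`μ-part`, `λ_an = n ≤ t(p−1)` ⇒ Mazur's main conjecture** at a reducible good ordinary `p ≠ 2` (no
constant-term input; the p. 132 step is the tree theorem behind
`Iwasawa.cyclotomicFactorPowAtTorsion_of_layerRankGEAt`). [cite: Wuthrich2014, Thm. 16 (p. 397)]
[cite: GreenbergLNM1716, §5 p. 132] -/
theorem mazurMainConjecture_of_layerRankGEAt_of_le
    (hW16 : Wuthrich2014.charIdeal_dvd_padicLFunction)
    (hp : p ≠ 2) (hgood : W.HasGoodReductionAtPrime p) (hord : ¬ (p : ℤ) ∣ W.frobeniusTrace p)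
    (hred : ¬ W.HasIrreducibleModPGaloisRep p) (hμ : MuLambda.MuPartAt W p) {n : ℕ}
    (hlam : AnalyticLambdaEq W p n) {r t : ℕ} (hr : W.mordellWeilRank ≤ r)
    (hm : Iwasawa.LayerRankGEAt W p 1 (r + (p - 1) * t)) (hn : n ≤ t * (p - 1)) :
    MazurMainConjecture W p :=
  mazurMainConjecture_of_cyclotomicFactorPowTorsion hW16 hp hgood hord hred hμ hlam
    (Iwasawa.cyclotomicFactorPowAtTorsion_of_layerRankGEAt hr hm) hn

end NoConstantTerm

section Leaf

variable {W : WeierstrassCurve ℚ} [W.IsElliptic] [W.IsGloballyMinimal] {p : ℕ} [Fact p.Prime]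

/-- **Leaf, certificate form: Mazur's main conjecture from a rank-growth certificate.** On
`RankZero.Leaf W p` the hypotheses `p ≠ 2`, good ordinary, `E[p]` reducible, `L(E,1) ≠ 0` of
`mazurMainConjecture_of_layerRankGEAt_pow` hold (`isClassX1_of_classX1`, modularity for
`L(E,1) ≠ 0`). [cite: GreenbergLNM1716, Thm. 1.2, Prop. 3.10, Thm. 4.1 and §5 p. 132]
[cite: Wuthrich2014, Thm. 16 (p. 397)] -/
theorem Leaf.mazurMainConjecture_of_layerRankGEAt_pow
    (hW16 : Wuthrich2014.charIdeal_dvd_padicLFunction) (hGr : greenberg_charValue_rankZero)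
    (h310 : prop310_selmerCorank_mod_two_eq_lambdaInvariant)
    (hmod : nonempty_modularParametrizationData) (hL : RankZero.Leaf W p)
    {m : ℕ} (hμan : AnalyticMuLE W p m) (hμ : MuLambda.MuPartAt W p) {n : ℕ} (hlam : AnalyticLambdaEq W p n)
    {t : ℕ} (hm : Iwasawa.LayerRankGEAt W p 1 ((p - 1) * t))
    (hb : m + t + 1 + 2 * padicValNat p W.torsionOrder ≤
      padicValNat p W.tamagawaProduct + 2 * padicValNat p (W.reductionPointCount p))
    (hn : n ≤ t * (p - 1) + 2) : MazurMainConjecture W p :=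
  have hX := isClassX1_of_classX1 hL.classX1
  CyclotomicFactorPow.mazurMainConjecture_of_layerRankGEAt_pow hW16 hGr h310 hX.two_ne
    hX.hasGoodReductionAtPrime
    hX.not_dvd_frobeniusTrace hX.not_hasIrreducibleModPGaloisRep
    (entireLFunction_one_ne_zero_of_analyticRank_eq_zero hmod W hL.analyticRank_eq_zero)
    hμan hμ hlam hm hb hn

/-- **Leaf, certificate form: `BSD(E,p)` from a rank-growth certificate** (main conjecture ⇒ BSD
on the leaf, `RankZero.Leaf.mazurMainConjecture_iff_bsdp`: Greenberg 4.1, modularity,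
Gross–Zagier–Kolyvagin, all PUBLISHED named facts). [cite: GreenbergLNM1716, Thm. 1.2, Prop. 3.10, Thm. 4.1 and §5 p. 132]
[cite: Wuthrich2014, Thm. 16 (p. 397)] -/
theorem Leaf.bsdp_of_layerRankGEAt_pow
    (hW16 : Wuthrich2014.charIdeal_dvd_padicLFunction) (hGr : greenberg_charValue_rankZero)
    (h310 : prop310_selmerCorank_mod_two_eq_lambdaInvariant)
    (hmod : nonempty_modularParametrizationData)
    (hGZK : rank_eq_analyticRank_of_analyticRank_le_one) (hL : RankZero.Leaf W p)
    {m : ℕ} (hμan : AnalyticMuLE W p m) (hμ : MuLambda.MuPartAt W p) {n : ℕ} (hlam : AnalyticLambdaEq W p n)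
    {t : ℕ} (hm : Iwasawa.LayerRankGEAt W p 1 ((p - 1) * t))
    (hb : m + t + 1 + 2 * padicValNat p W.torsionOrder ≤
      padicValNat p W.tamagawaProduct + 2 * padicValNat p (W.reductionPointCount p))
    (hn : n ≤ t * (p - 1) + 2) : BSDp W p :=
  (RankZero.Leaf.mazurMainConjecture_iff_bsdp hW16 hGr hmod hGZK hL).mp
    (Leaf.mazurMainConjecture_of_layerRankGEAt_pow hW16 hGr h310 hmod hL hμan hμ hlam hm hb hn)

/-- **Leaf, certificate form without the constant term: `BSD(E,p)`** from `MuPartAt`,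
`λ_an = n ≤ t(p − 1)` and a certificate `LayerRankGEAt W p 1 ((p−1)t)` (on the leaf `r_an = 0`, so
`rank E(ℚ) = 0` by Gross–Zagier–Kolyvagin, `hGZK`) — eisenstein-p1's
`Leaf.bsdp_of_cyclotomicFactor_of_le_pred` with the typed `ξ_p ∣ f_E` replaced by the certificate
(e.g. `λ_an = 4` at `p = 5`: a new point over `ℚ(ζ_25)⁺`). [cite: GreenbergLNM1716, Thm. 1.2 and §5 p. 132]
[cite: Wuthrich2014, Thm. 16 (p. 397)] -/
theorem Leaf.bsdp_of_layerRankGEAt_of_le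
    (hW16 : Wuthrich2014.charIdeal_dvd_padicLFunction) (hGr : greenberg_charValue_rankZero)
    (hmod : nonempty_modularParametrizationData)
    (hGZK : rank_eq_analyticRank_of_analyticRank_le_one) (hL : RankZero.Leaf W p)
    (hμ : MuLambda.MuPartAt W p) {n : ℕ} (hlam : AnalyticLambdaEq W p n) {t : ℕ}
    (hm : Iwasawa.LayerRankGEAt W p 1 ((p - 1) * t)) (hn : n ≤ t * (p - 1)) : BSDp W p := by
  have hX := isClassX1_of_classX1 hL.classX1
  have hr0 : W.mordellWeilRank ≤ 0 := by
    have h := (hGZK W (by rw [hL.analyticRank_eq_zero]; norm_num)).1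
    rw [hL.analyticRank_eq_zero] at h
    exact h.le
  exact (RankZero.Leaf.mazurMainConjecture_iff_bsdp hW16 hGr hmod hGZK hL).mp
    (mazurMainConjecture_of_layerRankGEAt_of_le hW16 hX.two_ne hX.hasGoodReductionAtPrime
      hX.not_dvd_frobeniusTrace hX.not_hasIrreducibleModPGaloisRep hμ hlam hr0
      (by rw [zero_add]; exact hm) hn)

/-- **Headline at `p = 3`, `μ_an = 0`, rank growth `+2` ('C' from a certificate): `rank E(ℚ_1) ≥ 2 ∧
λ_an = 4 ∧ 2 + 2·v_3 #E(ℚ)_tors ≤ v_3 ∏c_ℓ + 2·v_3 #Ẽ(𝔽_3) ⇒ BSD(E,3)`** — eisenstein-p1's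
`Leaf.bsdp_three_of_muZero_lamFour_of_cyclotomicFactor` with the typed `ξ_3 ∣ f_E` REPLACED by
the certificate `LayerRankGEAt W 3 1 2` (a point of infinite order over `ℚ(ζ_9)⁺` off `E(ℚ)·ℚ`, iw-1's
census datum). μ-part automatic at `μ_an = 0`. [cite: GreenbergLNM1716, Thm. 1.2, Prop. 3.10, Thm. 4.1 and §5 p. 132 (Conductor = 34, p = 3)]
[cite: Wuthrich2014, Thm. 16 (p. 397)] -/
theorem Leaf.bsdp_three_of_layerRankGE_two {W : WeierstrassCurve ℚ} [W.IsElliptic]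
    [W.IsGloballyMinimal] [Fact (3 : ℕ).Prime]
    (hW16 : Wuthrich2014.charIdeal_dvd_padicLFunction) (hGr : greenberg_charValue_rankZero)
    (h310 : prop310_selmerCorank_mod_two_eq_lambdaInvariant)
    (hmod : nonempty_modularParametrizationData)
    (hGZK : rank_eq_analyticRank_of_analyticRank_le_one) (hL : RankZero.Leaf W 3)
    (hμ0 : AnalyticMuLE W 3 0) (hlam : AnalyticLambdaEq W 3 4) (hm : Iwasawa.LayerRankGEAt W 3 1 2)
    (hb2 : 2 + 2 * padicValNat 3 W.torsionOrder ≤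
      padicValNat 3 W.tamagawaProduct + 2 * padicValNat 3 (W.reductionPointCount 3)) : BSDp W 3 :=
  have hX := isClassX1_of_classX1 hL.classX1
  Leaf.bsdp_of_layerRankGEAt_pow hW16 hGr h310 hmod hGZK hL hμ0
    (muPartAt_of_analyticMuLE_zero hW16 hX.two_ne hX.hasGoodReductionAtPrime
      hX.not_dvd_frobeniusTrace hX.not_hasIrreducibleModPGaloisRep hμ0) hlam (t := 1)
    (by simpa using hm) (by simpa using hb2) (by norm_num)

/-- **Headline at `p = 3`, `μ_an = 0`, rank growth `+4` ('C²' at a DOUBLE cyclotomic zero):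
`rank E(ℚ_1) ≥ 4 ∧ λ_an = 6 ∧ 3 + 2·v_3 #E(ℚ)_tors ≤ v_3 ∏c_ℓ + 2·v_3 #Ẽ(𝔽_3) ⇒ BSD(E,3)`** (the
shape of iw-1's `certified-rank-plus-4` datum; e.g. the class of conductor 11170 in their report,
owners' numbers and booking). [cite: GreenbergLNM1716, Thm. 1.2, Prop. 3.10, Thm. 4.1 and §5 p. 132]
[cite: Wuthrich2014, Thm. 16 (p. 397)] -/
theorem Leaf.bsdp_three_of_layerRankGE_four {W : WeierstrassCurve ℚ} [W.IsElliptic]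
    [W.IsGloballyMinimal] [Fact (3 : ℕ).Prime]
    (hW16 : Wuthrich2014.charIdeal_dvd_padicLFunction) (hGr : greenberg_charValue_rankZero)
    (h310 : prop310_selmerCorank_mod_two_eq_lambdaInvariant)
    (hmod : nonempty_modularParametrizationData)
    (hGZK : rank_eq_analyticRank_of_analyticRank_le_one) (hL : RankZero.Leaf W 3)
    (hμ0 : AnalyticMuLE W 3 0) (hlam : AnalyticLambdaEq W 3 6) (hm : Iwasawa.LayerRankGEAt W 3 1 4)
    (hb3 : 3 + 2 * padicValNat 3 W.torsionOrder ≤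
      padicValNat 3 W.tamagawaProduct + 2 * padicValNat 3 (W.reductionPointCount 3)) : BSDp W 3 :=
  have hX := isClassX1_of_classX1 hL.classX1
  Leaf.bsdp_of_layerRankGEAt_pow hW16 hGr h310 hmod hGZK hL hμ0
    (muPartAt_of_analyticMuLE_zero hW16 hX.two_ne hX.hasGoodReductionAtPrime
      hX.not_dvd_frobeniusTrace hX.not_hasIrreducibleModPGaloisRep hμ0) hlam (t := 2)
    (by simpa using hm) (by simpa using hb3) (by norm_num)

end Leaf

end Summit.BirchSwinnertonDyer.Rank1Residual.X1.CyclotomicFactorPow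

end
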